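import Summits.CriticalPhenomena.PercolationContinuityZ3.Theorems.Transplant.DiagonalConeCritical
import Summits.CriticalPhenomena.PercolationContinuityZ3.Theorems.Transplant.AxialConeDesign
import HarnessLib

/-!
# DIAGONAL CONES of `ℤ³` — V: the cut sets `{x₀+x₁+x₂ ≤ N}`, their exits, the argmin CLIMB and the slack it creates
# (first file of the uniqueness column for `ℂ_{τ,h} = {h ≤ x₀+x₁+x₂, xᵢ − xⱼ ≤ τ(x₀+x₁+x₂)}`)

builds on p205010 (kernel theorem, internal audit signed; external expert review pending) — NOT used in this file.
Lane `prim-bschramm`, seat `prim-bschramm-p2` (gen 29; class C1b = sub-domains of `ℤ³` at their own critical point, METHOD = input substitution;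
memo `HOME/bschramm/P2-LATTICES.md` §105); helper file (`--supports stmt-CriticalPhenomena-4575 --as helper`) for ROW N6 of TABLE v44
(cones containing no coordinate direction): the UNIQUENESS column `N ≤ 1` a.s. at every density, by the Aizenman–Chayes–Chayes–Fröhlich–Russo
exterior-connection mechanism in station form (`TubeSlabUniq.ae_numInfiniteClusters_le_one_of_station`).

THE DIFFICULTY AND THE DESIGN.  Every coordinate slab meets `ℂ_{τ,h}` (`τ < ½`) in a BOUNDED set and the cone pinches towards its apex, so
the window moves of the axial-cone design (`AxialConeDesign`: square windows swept towards the axis) do not fit: from a boundary point of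
vertex type `(lo, hi, hi)` no coordinate can be lowered (the height `x₀+x₁+x₂` must not decrease) and no maximal coordinate raised.  The
cure: (i) cut by HEIGHT — `Λ_N = {x₀+x₁+x₂ ≤ N} ∩ [-B_N, B_N]³` (this file), so that every exit has height exactly `N`; (ii) CLIMB `c`
argmin steps (`DiagonalConeGeometry.step_mem`; `c` sprinkled edges, probability one) — each step raises the height by one and never the
spread, so after `c` steps every pair inequality `xᵢ − xⱼ ≤ τ·height` holds with SLACK `cτ` (`climb_slack`); (iii) then raise the CURRENT
MINIMAL coordinate by a linear amount with one link move whose regions only INCREASE coordinates (`DiagonalConeMove`), five times, up to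
the diagonal station (`DiagonalConeUniqueness`).
* §1 `lowIdx` (an argmin coordinate), `climb n x` (iterate `x ↦ x + e_{lowIdx x}`): stays in `ℂ`, height `+n`, coordinates in `[xⱼ, xⱼ + n]`,
  **`climb_slack`**: `xᵢ − xⱼ + nτ ≤ τ·height` after `n` steps (when `τ·height(x) ≥ nτ + 1`);
* §2 coordinates of cone points are bounded by `(⌈τ⌉ + 1)·height` (`abs_le_of_mem`); the cut sets `cut B N` are finite, increasing,
  exhaust `ℤ³`, and their exits are cone points of height exactly `N` (`exit_of_cut`);
* §3 **`climb_datum`**: `n` extra open edges join `x` to `climb n x` through exterior steps of `Λ ⊆ {height ≤ N}` inside `ℂ` (probability one).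
[cite: AizenmanChayesChayesFrohlichRusso1983, §4 (4.26), Lemma 4.2 (a)] [cite: GrimmettPercolation1999, §7.2 p. 148; §11.5 notes p. 347]
[cite: ChayesChayes1986Wedges, §1] -/

noncomputable section

namespace Summit.CriticalPhenomena.PercolationContinuityZ3.Theorems.Transplant

namespace DiagCone

open MeasureTheory Literature.Probability.Percolation Literature.Probability.LatticeModels SimpleGraph HSU OrthantUniq HalfSlabUniq
  TubeSlabUniq DesignTransport WallUniq Filter
open scoped Classical

/-! ## §1 The argmin coordinate, the climb, the slack -/

/-- An argmin coordinate of `x ∈ ℤ³`. [folklore] -/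
def lowIdx (x : Site 3) : Fin 3 := if x 0 ≤ x 1 ∧ x 0 ≤ x 2 then 0 else if x 1 ≤ x 2 then 1 else 2

/-- `x_{lowIdx x} ≤ xⱼ` for every `j`. [folklore] -/
theorem lowIdx_le (x : Site 3) : ∀ j, x (lowIdx x) ≤ x j := by
  intro j
  unfold lowIdx
  by_cases h0 : x 0 ≤ x 1 ∧ x 0 ≤ x 2
  · rw [if_pos h0]; fin_cases j; exacts [le_rfl, h0.1, h0.2]
  · rw [if_neg h0]
    by_cases h1 : x 1 ≤ x 2
    · rw [if_pos h1]; fin_cases j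
      · show x 1 ≤ x 0
        by_contra h; exact h0 ⟨(not_le.1 h).le, (not_le.1 h).le.trans h1⟩
      · exact le_rfl
      · exact h1
    · rw [if_neg h1]; fin_cases j
      · show x 2 ≤ x 0
        by_contra h; push Not at h h1; exact h0 ⟨(h.trans h1).le, h.le⟩
      · exact (not_le.1 h1).le
      · exact le_rfl

/-- **The climb**: `n` argmin steps, `climb (n+1) x = climb n x + e_{lowIdx (climb n x)}`. [folklore] -/
def climb : ℕ → Site 3 → Site 3
  | 0, x => x
  | n + 1, x => climb n x + Pi.single (lowIdx (climb n x)) 1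

/-- `climb 0 x = x`. [folklore] -/
@[simp] theorem climb_zero (x : Site 3) : climb 0 x = x := rfl

/-- The successor step of the climb. [folklore] -/
theorem climb_succ (n : ℕ) (x : Site 3) : climb (n + 1) x = climb n x + Pi.single (lowIdx (climb n x)) 1 := rfl

/-- Coordinates after one argmin step: `+1` at the argmin, unchanged elsewhere. [folklore] -/
theorem step_apply (y : Site 3) (i j : Fin 3) : (y + (Pi.single i 1 : Site 3)) j = y j + if j = i then 1 else 0 := by
  simp [Pi.single_apply]

/-- Height after one step: `+1`. [folklore] -/
theorem step_sum (y : Site 3) (i : Fin 3) :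
    (y + (Pi.single i 1 : Site 3)) 0 + (y + (Pi.single i 1 : Site 3)) 1 + (y + (Pi.single i 1 : Site 3)) 2 = y 0 + y 1 + y 2 + 1 := by
  rw [step_apply, step_apply, step_apply]; fin_cases i <;> simp <;> ring

/-- **Height of the climb**: `+n`. [folklore] -/
theorem climb_sum (n : ℕ) (x : Site 3) : (climb n x) 0 + (climb n x) 1 + (climb n x) 2 = x 0 + x 1 + x 2 + n := by
  induction n with
  | zero => simp
  | succ n ih => rw [climb_succ, step_sum, ih]; push_cast; ring

/-- **Coordinates of the climb** lie in `[xⱼ, xⱼ + n]`. [folklore] -/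
theorem climb_apply_mem (n : ℕ) (x : Site 3) (j : Fin 3) : x j ≤ climb n x j ∧ climb n x j ≤ x j + n := by
  induction n with
  | zero => simp
  | succ n ih =>
    rw [climb_succ, step_apply]
    obtain ⟨h1, h2⟩ := ih
    by_cases hj : j = lowIdx (climb n x)
    · rw [if_pos hj]; push_cast; constructor <;> omega
    · rw [if_neg hj]; push_cast; constructor <;> omega

/-- Consecutive climb points are lattice neighbours. [folklore] -/
theorem climb_adj (n : ℕ) (x : Site 3) : (zdGraph 3).Adj (climb n x) (climb (n + 1) x) := by
  rw [climb_succ, zdGraph_adj_iff]; exact ⟨_, Or.inl rfl⟩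

section Cone

variable {τ h : ℝ} (hτ : 0 < τ) (hh : 1 ≤ τ * h) {D : Set (Site 3)}
  (hCD : ∀ x : Site 3, x ∈ D ↔
    h ≤ ((x 0 + x 1 + x 2 : ℤ) : ℝ) ∧ ∀ i j : Fin 3, ((x i - x j : ℤ) : ℝ) ≤ τ * ((x 0 + x 1 + x 2 : ℤ) : ℝ))

include hτ hh hCD in
/-- **The climb stays in the cone** (argmin steps, `DiagonalConeGeometry.step_mem`). [folklore] -/
theorem climb_mem {x : Site 3} (hx : x ∈ D) : ∀ n, climb n x ∈ D := by
  intro n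
  induction n with
  | zero => exact hx
  | succ n ih => rw [climb_succ]; exact step_mem hτ hh hCD ih _ (lowIdx_le _)

include hτ hCD in
/-- **THE SLACK CREATED BY THE CLIMB.**  If `x ∈ ℂ` and `τ·height(x) ≥ nτ + 1` then after `m ≤ n` argmin steps every pair inequality holds
with slack `mτ`: `yᵢ − yⱼ + mτ ≤ τ·height(y)`, `y = climb m x` (a step raises the height by one — slack `+τ` for every pair whose difference
did not grow — and the only differences that grow are `y_{argmin} + 1 − yⱼ ≤ 1 ≤ τ·height − nτ`). [folklore] -/
theorem climb_slack {x : Site 3} (hx : x ∈ D) {n : ℕ} (hn : (n : ℝ) * τ + 1 ≤ τ * ((x 0 + x 1 + x 2 : ℤ) : ℝ)) :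
    ∀ m, m ≤ n → ∀ i j : Fin 3, ((climb m x i - climb m x j : ℤ) : ℝ) + m * τ ≤
      τ * ((climb m x 0 + climb m x 1 + climb m x 2 : ℤ) : ℝ) := by
  intro m
  induction m with
  | zero =>
    intro _ i j
    simpa using ((hCD x).1 hx).2 i j
  | succ m ih =>
    intro hm i j
    have ih' := ih (by omega)
    set y := climb m x with hy
    have hsum_y : ((y 0 + y 1 + y 2 : ℤ) : ℝ) = ((x 0 + x 1 + x 2 : ℤ) : ℝ) + m := by
      rw [hy, climb_sum]; push_cast; ring
    push_cast at hsum_y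
    have hmn : ((m : ℕ) : ℝ) + 1 ≤ n := by exact_mod_cast hm
    have hmτ : (((m : ℕ) : ℝ) + 1) * τ ≤ n * τ := mul_le_mul_of_nonneg_right hmn hτ.le
    have hmτ0 : 0 ≤ ((m : ℕ) : ℝ) * τ := by positivity
    have hn' := hn
    push_cast at hn'
    have key : τ * (((y 0 : ℤ) : ℝ) + y 1 + y 2 + 1) = τ * (((x 0 : ℤ) : ℝ) + x 1 + x 2) + m * τ + τ := by rw [hsum_y]; ring
    set l := lowIdx y with hl
    rw [climb_succ, ← hy, step_sum, step_apply, step_apply]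
    push_cast
    by_cases hi : i = l
    · by_cases hj : j = l
      · rw [if_pos hi, if_pos hj]
        have hij0 : y i = y j := by rw [hi, hj]
        have hij1 : ((y i : ℤ) : ℝ) = y j := by exact_mod_cast hij0
        linarith
      · rw [if_pos hi, if_neg hj]
        have hle0 : y i ≤ y j := by rw [hi]; exact lowIdx_le y j
        have hle : ((y i : ℤ) : ℝ) ≤ y j := by exact_mod_cast hle0
        linarith
    · rw [if_neg hi]
      have hij := ih' i j
      push_cast at hij
      by_cases hj : j = l
      · rw [if_pos hj]; linarith
      · rw [if_neg hj]; linarith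

/-! ## §2 Coordinates of cone points; the cut sets by height and their exits -/

include hτ hh hCD in
/-- **Coordinates of a cone point are bounded by its height**: `−τs ≤ xⱼ ≤ s/3 + τs`, hence `|xⱼ| ≤ (⌈τ⌉ + 1)·S` when `height ≤ S`. [folklore] -/
theorem abs_le_of_mem {x : Site 3} (hx : x ∈ D) {S : ℕ} (hS : x 0 + x 1 + x 2 ≤ (S : ℤ)) :
    ∀ j, |x j| ≤ (((⌈τ⌉₊ + 1) * S : ℕ) : ℤ) := by
  obtain ⟨hs, hd⟩ := (hCD x).1 hx
  have h0 := h_pos hτ hh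
  have hspos : (0 : ℝ) < ((x 0 + x 1 + x 2 : ℤ) : ℝ) := h0.trans_le hs
  have hSr : ((x 0 + x 1 + x 2 : ℤ) : ℝ) ≤ (S : ℝ) := by exact_mod_cast hS
  have hτc : τ ≤ (⌈τ⌉₊ : ℝ) := Nat.le_ceil τ
  have hτS : τ * ((x 0 + x 1 + x 2 : ℤ) : ℝ) ≤ (⌈τ⌉₊ : ℝ) * S :=
    mul_le_mul hτc hSr hspos.le (by positivity)
  intro j
  rw [abs_le]
  have hup : ∀ i, ((x i : ℤ) : ℝ) ≤ ((⌈τ⌉₊ + 1) * S : ℕ) := by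
    intro i
    -- `3 x_i ≤ s + 2τ s`: from `x_i - x_k ≤ τ s` for the two other coordinates
    have e0 := hd i 0; have e1 := hd i 1; have e2 := hd i 2
    push_cast at e0 e1 e2 hSr hτS ⊢
    fin_cases i <;> push_cast at e0 e1 e2 ⊢ <;> nlinarith
  have hlo : ∀ i, -((((⌈τ⌉₊ + 1) * S : ℕ) : ℤ) : ℝ) ≤ ((x i : ℤ) : ℝ) := by
    intro i
    have e0 := hd 0 i; have e1 := hd 1 i; have e2 := hd 2 i
    push_cast at e0 e1 e2 hSr hτS ⊢
    have hS0 : (0 : ℝ) ≤ S := by positivity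
    fin_cases i <;> push_cast at e0 e1 e2 ⊢ <;> nlinarith
  exact ⟨by exact_mod_cast hlo j, by exact_mod_cast hup j⟩

/-- **The cut sets by height**: `Λ_N = {x ∈ ℤ³ | x₀+x₁+x₂ ≤ N} ∩ [-B_N, B_N]³`. [cite: AizenmanChayesChayesFrohlichRusso1983, §4 (4.26)] -/
def cut (B : ℕ → ℕ) (N : ℕ) : Set (Site 3) := {x | x 0 + x 1 + x 2 ≤ (N : ℤ) ∧ x ∈ boxSet 3 (B N)}

/-- Membership in a cut set. [folklore] -/
theorem mem_cut {B : ℕ → ℕ} {N : ℕ} {x : Site 3} : x ∈ cut B N ↔ x 0 + x 1 + x 2 ≤ (N : ℤ) ∧ x ∈ boxSet 3 (B N) := Iff.rfl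

/-- Cut sets are finite. [folklore] -/
theorem cut_finite (B : ℕ → ℕ) (N : ℕ) : (cut B N).Finite := (boxSet_finite (B N)).subset fun _ hx => hx.2

/-- Cut sets increase when `B` does. [folklore] -/
theorem cut_mono {B : ℕ → ℕ} (hB : Monotone B) : Monotone (cut B) := by
  intro N N' hNN x hx
  exact ⟨hx.1.trans (by exact_mod_cast hNN), boxSet_mono (hB hNN) hx.2⟩

/-- Cut sets exhaust `ℤ³` when `N ≤ B_N`. [folklore] -/
theorem cut_exhaust {B : ℕ → ℕ} (hB : Monotone B) (hNB : ∀ N, N ≤ B N) (x : Site 3) : ∃ N, x ∈ cut B N := by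
  obtain ⟨N₁, hN₁⟩ := boxSet_exhaust x
  refine ⟨max N₁ (x 0 + x 1 + x 2).toNat, ?_, boxSet_mono ((hNB N₁).trans (hB (le_max_left _ _))) hN₁⟩
  have h1 : x 0 + x 1 + x 2 ≤ ((x 0 + x 1 + x 2).toNat : ℤ) := Int.self_le_toNat _
  have h2 : ((x 0 + x 1 + x 2).toNat : ℤ) ≤ ((max N₁ (x 0 + x 1 + x 2).toNat : ℕ) : ℤ) := by exact_mod_cast le_max_right _ _
  exact h1.trans h2

include hτ hh hCD in
/-- **Exits of a cut set.**  With `B_N = (⌈τ⌉ + 1)(N + 1)`, a point of `Λ_N` with a `ℂ`-neighbour outside `Λ_N` is a cone point of height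
exactly `N` (the neighbour has height `≤ N + 1`, hence lies in the box, hence has height `N + 1`). [cite: AizenmanChayesChayesFrohlichRusso1983, §4 (4.26)] -/
theorem exit_of_cut {N : ℕ} {u : Site 3} (hu : u ∈ cut (fun N => (⌈τ⌉₊ + 1) * (N + 1)) N)
    (hw : ∃ w, w ∉ cut (fun N => (⌈τ⌉₊ + 1) * (N + 1)) N ∧ (withinGraph (zdGraph 3) D).Adj u w) :
    u ∈ D ∧ u 0 + u 1 + u 2 = N := by
  obtain ⟨w, hwΛ, hadj⟩ := hw
  rw [withinGraph_adj] at hadj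
  obtain ⟨hzd, huD, hwD⟩ := hadj
  have hu1 : u 0 + u 1 + u 2 ≤ (N : ℤ) := hu.1
  have hws : w 0 + w 1 + w 2 ≤ u 0 + u 1 + u 2 + 1 := by
    obtain ⟨j, hj | hj⟩ := (zdGraph_adj_iff u w).1 hzd
    · rw [hj, step_sum]
    · rw [hj, step_sum]; omega
  have hwbox : w ∈ boxSet 3 ((⌈τ⌉₊ + 1) * (N + 1)) :=
    subset_boxSet_of_abs_le (S := {w}) (fun x hx j => by
      rw [Set.mem_singleton_iff.1 hx]; exact abs_le_of_mem hτ hh hCD hwD (S := N + 1) (by push_cast; omega) j)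
      (Set.mem_singleton w)
  have hwgt : ¬ (w 0 + w 1 + w 2 ≤ (N : ℤ)) := fun hle => hwΛ ⟨hle, hwbox⟩
  exact ⟨huD, by omega⟩

include hτ hh hCD in
/-- Cone points of height `≤ N + 1` lie in the box `[-B_N, B_N]³`, `B_N = (⌈τ⌉ + 1)(N + 1)`. [folklore] -/
theorem mem_boxSet_of_height {N : ℕ} {x : Site 3} (hx : x ∈ D) (hs : x 0 + x 1 + x 2 ≤ (N : ℤ) + 1) :
    x ∈ boxSet 3 ((⌈τ⌉₊ + 1) * (N + 1)) :=
  subset_boxSet_of_abs_le (S := {x}) (fun y hy j => by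
    rw [Set.mem_singleton_iff.1 hy]; exact abs_le_of_mem hτ hh hCD hx (S := N + 1) (by push_cast; omega) j)
    (Set.mem_singleton x)

/-! ## §3 The climb as a station design datum -/

include hτ hh hCD in
/-- **The climb as a datum**: if `x ∈ ℂ` has height `≥ N`, `Λ ⊆ {height ≤ N}` and `|xⱼ| + n ≤ M`, then `n` extra open edges of `[-M, M]³` join
`x` to `climb n x` through open exterior steps of `Λ` inside `ℂ`, with probability one (every climb point after the first has height `> N`).
[cite: AizenmanChayesChayesFrohlichRusso1983, §4 Lemma 4.2 (a)] -/
theorem climb_datum {N : ℕ} {Λ : Set (Site 3)} (hΛ : ∀ y ∈ Λ, y 0 + y 1 + y 2 ≤ (N : ℤ)) {M : ℕ} (p' : unitInterval) {x : Site 3} (hx : x ∈ D)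
    (hxN : (N : ℤ) ≤ x 0 + x 1 + x 2) :
    ∀ n : ℕ, (∀ j, |x j| + n ≤ (M : ℤ)) →
      ∃ E : Set (BondConfig (Site 3)), IsUpperSet E ∧ MeasurableSet E ∧ DeterminedBy E ↑(edgesIn (zdGraph 3) (box 3 M)) ∧
        (1 : ℝ) ≤ (bondPercolation (zdGraph 3) p').real E ∧
        ∀ ω ∈ E, ∃ F : Finset (Sym2 (Site 3)), F ⊆ edgesIn (zdGraph 3) (box 3 M) ∧ F.card ≤ n ∧
          ω ∪ ↑F ∈ openConnVia (starGraph (withinGraph (zdGraph 3) D) Set.univ Λ) x (climb n x) := by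
  intro n
  induction n with
  | zero =>
    intro _
    refine ⟨Set.univ, isUpperSet_univ, MeasurableSet.univ, determinedBy_univ _, by rw [probReal_univ], fun ω _ => ⟨∅, by simp, by simp, ?_⟩⟩
    rw [Finset.coe_empty, Set.union_empty]
    exact mem_openConnVia_iff.2 (by simp)
  | succ n ih =>
    intro hM
    have h₁ := ih (fun j => by have := hM j; push_cast at this ⊢; omega)
    have hbd : ∀ m, m ≤ n + 1 → ∀ j, |climb m x j| ≤ (M : ℤ) := by
      intro m hm j
      obtain ⟨a1, a2⟩ := climb_apply_mem m x j
      have h1 := hM j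
      have h2 := le_abs_self (x j); have h3 := neg_abs_le (x j)
      rw [abs_le]; push_cast at h1 ⊢; constructor <;> omega
    have hout : climb (n + 1) x ∉ Λ := fun hmem => by
      have := hΛ _ hmem; rw [climb_sum] at this; push_cast at this; omega
    have h₂ := step_datum (D := D) (Λ := Λ) (M := M) p' (climb_adj n x) (climb_mem hτ hh hCD hx n)
      (climb_mem hτ hh hCD hx (n + 1)) (fun h => hout h.2) (hbd n (by omega)) (hbd (n + 1) le_rfl)
    have h₃ := design_chain zero_le_one h₁ h₂
    rw [one_mul] at h₃
    exact h₃

end Cone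

end DiagCone

end Summit.CriticalPhenomena.PercolationContinuityZ3.Theorems.Transplant

end
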